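import Literature.NumberTheory.Automorphic.Liu2021.Def411WeilCarriersTripleSeparation
import Literature.NumberTheory.Automorphic.Liu2021.LemD1IsotropyOfPlace
import Literature.NumberTheory.Automorphic.Liu2021.LemD1LocalInjectivity
import Literature.RepresentationTheory.MoeglinVignerasWaldspurger1987.RankOneThetaLiftSeparation
import Literature.RepresentationTheory.MoeglinVignerasWaldspurger1987.RankOneThetaLiftLinesEquivalent
import Literature.RepresentationTheory.MoeglinVignerasWaldspurger1987.RankOneThetaLiftNonvanishingProofs
import HarnessLib

/-!
# [Liu2021, Lem. D.1 (3)] AT A FINITE PLACE on the indexed family `localIndexedFamilyAtV`: the `(ε, χ)`-clauses (→) at a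
# NON-SPLIT place from the SEPARATION of rank-one theta lifts, through a line-model transport — THEOREMS ONLY

Topic `NumberTheory/Automorphic/Liu2021`; namespaces `Literature.NumberTheory.Automorphic.Liu2021` (§0, generic),
`….Liu2021.LemD1OfPlace` (§1, the local model `E_v = E ⊗_F F_v`) and `….Liu2021.Def411WeilCarriers` (§2–§3, the indexed family
`localIndexedFamilyAtV … v` of `Def411WeilCarriersLocalDataAtV.lean`).  KERNEL ONLY: theorems, no definition, no named fact, no
`sorry`.  Nothing of [Liu2021] or [MoeglinVignerasWaldspurger1987] is asserted: the `ε`-separation row IV-4c1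
`rankOne_theta_lines_disjoint` (`RankOneThetaLiftLinesDisjoint.lean`, D-0014) enters §3 as the HYPOTHESIS `h`.

## What this file is, and why (cell hodgecm-mathlib, fan A, line `a4-liuD3`, stub `stub_sameClass_and_chi_of_iso_nonsplit`)

The binder `hD3` of the cell's headline is [Liu2021, App. D Lem. D.1 (3)] AS PRINTED («If `n ≥ 3`, then `ω(μ', ε', χ')` is
isomorphic to `ω(μ, ε, χ)` if and only if `(μ', ε', χ') = (μ, ε, χ)`», l. 5233) read on the INDEXED FAMILY
`localIndexedFamilyAtV … v` (`LemD1_3AsPrintedI`): one standing data `U(J_V)(F_v)`, member `t` = (line `⟨a_t⟩` with Step-1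
representative `ε_{t,v} = (a_t δ) ⊗ 1`, Step-3 character `χ_{t,v} ∘ θ`, carrier `(𝓢_t).omegaLoc v ∘ (k ↦ k ⊗ 1) ∘ uEquiv` — the
local Weil representation of the pair `U(J_V ⊗ (a_t))`, whose Schrödinger model `LocalMp F n (gram e T_V (a_t)) v` DEPENDS ON
`a_t`).  The tree's separation statements for rank-one theta lifts — [MoeglinVignerasWaldspurger1987, Chap. 3 §IV] currency,
`RankOneThetaLift*.lean`: the `χ`-clause `rankOne_thetaChar_eq_of_areIsomorphicRep₂` (PROVED), the `ε`-clause IV-4c1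
`rankOne_theta_lines_disjoint` (named fact) and their package `rankOne_theta_epsClass_and_char_eq_of_areIsomorphicRep`
(`RankOneThetaLiftSeparation.lean`) — speak of ONE model `LocalMp F 3 T_V v` and sections `s₁, s₂` over the embeddings
`ι_{δ₁}, ι_{δ₂}` of TWO LINES.  This file is the bookkeeping between the two currencies, given for each member a LINE-MODEL
TRANSPORT: a section `s_t : U(J_V)(F_v) →* LocalMp F N T_V v` and a linear equivalence `M_t : 𝒮(F_vᴺ) ≃ 𝒮(F_vⁿ)` with
`M_t ω_{s_t}(g) = ((𝓢_t).omegaLoc v)(g ⊗ 1) M_t` (for `e = Equiv.prodUnique`, `gram = a_t • T_V`: `δ'_t = a_t⁻¹ δ`, `M_t = 1`,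
the `e′_a : (x, y) ↦ (x, a_t y)` transport of [MoeglinVignerasWaldspurger1987, Chap. 2 II Remarque (3)]; supplied by the
tree's model-transport file, not here):

* §0 (generic) `AreIsomorphicRep.comp` ∕ `AreIsomorphicRep.of_comp_surjective` — «isomorphic» (READING L7) along ∕ down a
  (surjective) homomorphism of the group; `areIsomorphicRep_coinv_of_ker_eq` — coinvariants of ONE space by EQUAL relation
  submodules, acted on by the same operators, are isomorphic (identity on representatives);
* §1 `LemD1OfPlace.ker_localCenter_eq_of_line` — the relation submodule of the `χ_v`-coinvariants of `ω` under the centre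
  `E_v¹` does not depend on the `1 × 1` line `J₁` presenting it (`θ` onto, `localCenter_theta`, `localCharOfCenter_theta_eq`);
  `LemD1OfPlace.isIsotropic_standingData_of_three_le` — a hermitian space of rank `≥ 3` over `E_v` is ISOTROPIC (trace form in
  `≥ 6` variables, `u(F_v) ≤ 4`: `exists_quadraticForm_trace_form`, `QuadraticForms.not_anisotropic_of_five_le_finrank_adicCompletion`,
  `form_self_eq_zero_of_trace_eq_zero`) — the hypothesis `hiso` of `mvw_IV2_rankOne_nonvanishing_of_isotropic` at the space `V` itself;
* §2 `sameClass_eps_localIndexedFamilyAtV_iff` (`Iff.rfl`: the `ε`-summand is a units equation) and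
  **`areIsomorphicRep_theta_comp_uEquiv_quot`** — ONE MEMBER along a line-model transport: `quot t` (the member's
  `ω(μ_v, ε_v, χ_v)` on `S.U`) `≅ Θ_{s_t}(χ_{t,v}) ∘ uEquiv` for EVERY line `J₁` presenting the centre (chain `quotEquivLocalType` ·
  `ker_comp_localLineInl_eq` · `TwistedCoinv.exists_equivariant_of_equivariant` along `M_t` · §1);
* §3 **`sameClass_and_chi_eq_of_areIsomorphicRep_nonsplit_of_modelTransport`** — `N = 3`, `E_v` a field: under
  `h : rankOne_theta_lines_disjoint` and transports for all members (`δ'_t ⊗ 1` in the class of `(a_t δ) ⊗ 1`, `hy`),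
  `AreIsomorphicRep (quot j) (quot i) → LemD1.SameClass (eps i) (eps j) ∧ chi j = chi i` — the `ε`- and `χ`-summands of
  `LemD1_3AsPrintedI`'s right-hand side; non-vanishing of `Θ_{s_j}(χ_j)` is MVW IV.2 PROVED
  (`mvw_IV2_rankOne_nonvanishing_of_isotropic_holds`) at the isotropic rank-3 space.

HC_CM is proved only modulo the 7 printed citations (`hDel`, `h21`, `hLiu418`, `h411`, `h413`, `hD3`, `hD1''`) until rung 0 closes;
this file discharges none of them and no interface fact.

## References
* [Liu2021] Y. Liu, Camb. J. Math. 9 (2021) = arXiv:2102.11518 — App. D §D.1 Steps 1–3 (l. 5213–5224), Lemma D.1 (3) (l. 5233)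
  and its proof (l. 5255: «known when `n = 3` by [GR90, Proposition 5.1.4]»).
* [MoeglinVignerasWaldspurger1987] C. Mœglin, M.-F. Vignéras, J.-L. Waldspurger, LNM 1291, Chap. 2 II.1 and Remarque (3),
  Chap. 3 I.1–I.3, IV.2, IV.4.
* [GelbartRogawski1990] S. Gelbart, J. Rogawski, PS-Festschrift I (1990), Prop. 5.1.4 (via [Liu2021]).
* [Lam2005] T. Y. Lam, GSM 67, Ch. VI Thm 2.12 (`u(F_v) = 4`).
-/

set_option autoImplicit false

noncomputable section

open scoped Matrix Kronecker
open NumberField IsDedekindDomain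
open Literature.NumberTheory.Automorphic Literature.NumberTheory.Automorphic.UnitaryGroup
open Literature.RepresentationTheory
open Literature.RepresentationTheory.HeisenbergGroup (MpPsi)
open Literature.NumberTheory.GelbartRogawski1991 Literature.NumberTheory.GelbartRogawski1991.UnitaryDualPair
open Literature.NumberTheory.GelbartRogawski1991.UnitaryDualPair.WeilCoinv
open Literature.NumberTheory.GelbartRogawski1991.UnitaryDualPair.LocalSplitting (iota LocalMp localSchrodinger)
open Literature.RepresentationTheory.MoeglinVignerasWaldspurger1987

/-! ## §0 Generic bookkeeping: «isomorphic» along a surjection of the group and along equal relation submodules -/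

namespace Literature.NumberTheory.Automorphic.Liu2021

section Generic

variable {G G' V₁ V₂ : Type*} [Group G] [Group G'] [AddCommGroup V₁] [Module ℂ V₁] [AddCommGroup V₂] [Module ℂ V₂]

/-- «isomorphic» (READING L7) is preserved by pulling both representations back along a homomorphism `φ : G' →* G`.
[cite: Liu2021, App. D Lemma D.1 (3) (l. 5233)] -/
theorem AreIsomorphicRep.comp {ρ₁ : Representation ℂ G V₁} {ρ₂ : Representation ℂ G V₂} (h : AreIsomorphicRep ρ₁ ρ₂)
    (φ : G' →* G) :
    AreIsomorphicRep (show Representation ℂ G' V₁ from ρ₁.comp φ) (show Representation ℂ G' V₂ from ρ₂.comp φ) := by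
  obtain ⟨f, hf⟩ := h
  exact ⟨f, fun g v => hf (φ g) v⟩

/-- «isomorphic» (READING L7) descends along a SURJECTIVE homomorphism `φ : G' →* G`: if `ρ₁ ∘ φ ≅ ρ₂ ∘ φ` then `ρ₁ ≅ ρ₂`
(the same linear equivalence intertwines). [cite: Liu2021, App. D Lemma D.1 (3) (l. 5233)] -/
theorem AreIsomorphicRep.of_comp_surjective {ρ₁ : Representation ℂ G V₁} {ρ₂ : Representation ℂ G V₂} (φ : G' →* G)
    (hφ : Function.Surjective φ)
    (h : AreIsomorphicRep (show Representation ℂ G' V₁ from ρ₁.comp φ) (show Representation ℂ G' V₂ from ρ₂.comp φ)) :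
    AreIsomorphicRep ρ₁ ρ₂ := by
  obtain ⟨f, hf⟩ := h
  refine ⟨f, fun g v => ?_⟩
  obtain ⟨g', rfl⟩ := hφ g
  exact hf g' v

/-- Two coinvariant spaces of ONE space `S` by EQUAL relation submodules (possibly for different acting groups `H₁`, `H₂`),
with `G`-actions given on representatives by the same operators `ρ g`, are «isomorphic» (identity on representatives,
`Submodule.quotEquivOfEq`). [cite: Liu2021, App. D §D.1 Step 3 (l. 5221)] -/
theorem areIsomorphicRep_coinv_of_ker_eq {H₁ H₂ S : Type*} [Group H₁] [Group H₂] [AddCommGroup S] [Module ℂ S]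
    {ρW₁ : Representation ℂ H₁ S} {χ₁ : H₁ →* ℂˣ} {ρW₂ : Representation ℂ H₂ S} {χ₂ : H₂ →* ℂˣ}
    (hker : TwistedCoinv.ker ρW₁ χ₁ = TwistedCoinv.ker ρW₂ χ₂)
    (π₁ : Representation ℂ G (TwistedCoinv.Coinv ρW₁ χ₁)) (π₂ : Representation ℂ G (TwistedCoinv.Coinv ρW₂ χ₂))
    (ρ : G → S →ₗ[ℂ] S)
    (h₁ : ∀ (g : G) (v : S), π₁ g (TwistedCoinv.mk ρW₁ χ₁ v) = TwistedCoinv.mk ρW₁ χ₁ (ρ g v))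
    (h₂ : ∀ (g : G) (v : S), π₂ g (TwistedCoinv.mk ρW₂ χ₂ v) = TwistedCoinv.mk ρW₂ χ₂ (ρ g v)) :
    AreIsomorphicRep π₁ π₂ := by
  refine ⟨Submodule.quotEquivOfEq _ _ hker, fun g x => ?_⟩
  obtain ⟨v, rfl⟩ := TwistedCoinv.mk_surjective ρW₁ χ₁ x
  rw [h₁]
  change Submodule.quotEquivOfEq _ _ hker (Submodule.Quotient.mk (ρ g v)) =
    π₂ g (Submodule.quotEquivOfEq _ _ hker (Submodule.Quotient.mk v))
  rw [Submodule.quotEquivOfEq_mk, Submodule.quotEquivOfEq_mk]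
  exact (h₂ g v).symm

end Generic

/-! ## §1 At the place `v`: the relation submodule does not depend on the line presenting the centre; isotropy for `N ≥ 3` -/

namespace LemD1OfPlace

variable {F : Type} (E : Type) [Field F] [NumberField F] [Field E] [NumberField E] [Algebra F E]
  [Algebra.IsQuadraticExtension F E] (v : HeightOneSpectrum (𝓞 F)) (c : E ≃ₐ[F] E) (N : ℕ) (J : Matrix (Fin N) (Fin N) E)
  {δ : E} (hcδ : c δ = -δ) (hδ : δ ≠ 0) (hN : 2 ≤ N) (hJh : (J.map c)ᵀ = J) (hJdet : J.det ≠ 0)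

include hcδ hδ hN hJh hJdet in
/-- **The relation submodule of the `χ_v`-coinvariants of `ω` under the local centre does not depend on the `1 × 1` line
`J₁` presenting the centre**: `ker (ω ∘ localCenter_{J₁}) χ_{v,J₁} = ker (ω ∘ localCenter_{J₁'}) χ_{v,J₁'}` — both are the
relation submodule for the norm-one scalars `E_v¹` acting through `θ` (onto, `theta_surjective`; `localCenter_theta`,
`localCharOfCenter_theta_eq`). [cite: Liu2021, App. D §D.1 Step 3 (l. 5221)] -/
theorem ker_localCenter_eq_of_line {S : Type*} [AddCommGroup S] [Module ℂ S] (ω : Representation ℂ (localPi E c N J v) S)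
    (χ₁ : finAdelicOne F E c →* ℂˣ) (J₁ J₁' : Matrix (Fin 1) (Fin 1) E) (hJ₁ : J₁ 0 0 ≠ 0) (hJ₁' : J₁' 0 0 ≠ 0) :
    TwistedCoinv.ker (show Representation ℂ (localPi E c 1 J₁ v) S from ω.comp (localCenter E c N J J₁ hJ₁ v))
        (localCharOfCenter F E c J₁ hJ₁ χ₁ v) =
      TwistedCoinv.ker (show Representation ℂ (localPi E c 1 J₁' v) S from ω.comp (localCenter E c N J J₁' hJ₁' v))
        (localCharOfCenter F E c J₁' hJ₁' χ₁ v) := by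
  rw [← TwistedCoinv.ker_comp_of_surjective _ (localCharOfCenter F E c J₁ hJ₁ χ₁ v)
      (theta E v c N J hcδ hδ hN hJh hJdet J₁) (theta_surjective E v c N J hcδ hδ hN hJh hJdet J₁ hJ₁),
    ← TwistedCoinv.ker_comp_of_surjective _ (localCharOfCenter F E c J₁' hJ₁' χ₁ v)
      (theta E v c N J hcδ hδ hN hJh hJdet J₁') (theta_surjective E v c N J hcδ hδ hN hJh hJdet J₁' hJ₁')]
  have hρ : (show Representation ℂ (standingData E v c N J hcδ hδ hN hJh hJdet).normOne S from
        (show Representation ℂ (localPi E c 1 J₁ v) S from ω.comp (localCenter E c N J J₁ hJ₁ v)).comp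
          (theta E v c N J hcδ hδ hN hJh hJdet J₁)) =
      (show Representation ℂ (standingData E v c N J hcδ hδ hN hJh hJdet).normOne S from
        (show Representation ℂ (localPi E c 1 J₁' v) S from ω.comp (localCenter E c N J J₁' hJ₁' v)).comp
          (theta E v c N J hcδ hδ hN hJh hJdet J₁')) := by
    refine MonoidHom.ext fun z => ?_
    change ω (localCenter E c N J J₁ hJ₁ v (theta E v c N J hcδ hδ hN hJh hJdet J₁ z)) =
      ω (localCenter E c N J J₁' hJ₁' v (theta E v c N J hcδ hδ hN hJh hJdet J₁' z))
    rw [localCenter_theta, localCenter_theta]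
  have hχ : (localCharOfCenter F E c J₁ hJ₁ χ₁ v).comp (theta E v c N J hcδ hδ hN hJh hJdet J₁) =
      (localCharOfCenter F E c J₁' hJ₁' χ₁ v).comp (theta E v c N J hcδ hδ hN hJh hJdet J₁') :=
    MonoidHom.ext fun z => Def411WeilCarriers.localCharOfCenter_theta_eq F E c N J hcδ hδ hN hJh hJdet v J₁ J₁' hJ₁ hJ₁' χ₁ z
  rw [hχ]
  exact congrArg (fun ρ => TwistedCoinv.ker ρ _) hρ

/-- **A hermitian space of rank `N ≥ 3` over `E_v = E ⊗_F F_v` is isotropic** — the standing data `standingData … J …` at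
`v` (`J` hermitian, `det J ≠ 0`) has a non-zero `x` with `h(x, x) = 0`: the trace form `x ↦ Tr_{E_v/F_v} h(x,x)` is an
`F_v`-quadratic form in `2N ≥ 6` variables (`exists_quadraticForm_trace_form`, `five_le_finrank_pi_localRing`), hence has a
non-trivial zero (`u(F_v) ≤ 4`, tree `QuadraticForms.not_anisotropic_of_five_le_finrank_adicCompletion`), which is a zero of
`h` (`form_self_eq_zero_of_trace_eq_zero`).  The hypothesis `hiso` of `mvw_IV2_rankOne_nonvanishing_of_isotropic` at any
rank `≥ 3`. [cite: Liu2021, App. D Lemma D.1 (1) (l. 5229)] [cite: Lam2005, Ch. VI Thm 2.12] -/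
theorem isIsotropic_standingData_of_three_le (h3 : 3 ≤ N) :
    LemD1.IsIsotropic (standingData E v c N J hcδ hδ hN hJh hJdet) := by
  obtain ⟨Q, hQ⟩ := (standingData E v c N J hcδ hδ hN hJh hJdet).exists_quadraticForm_trace_form
  have hna := Literature.NumberTheory.QuadraticForms.not_anisotropic_of_five_le_finrank_adicCompletion F v Q
    (five_le_finrank_pi_localRing E v h3)
  simp only [QuadraticMap.Anisotropic, not_forall] at hna
  obtain ⟨x, hQx, hx⟩ := hna
  exact ⟨x, hx, form_self_eq_zero_of_trace_eq_zero E v c N J hcδ hδ hN hJh hJdet x (by rw [← hQ]; exact hQx)⟩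

end LemD1OfPlace


/-! ## §2 One member of `localIndexedFamilyAtV … v` along a LINE-MODEL TRANSPORT: its `ω(μ_v, ε_v, χ_v)` is «isomorphic» to
the rank-one theta lift `Θ_s(χ_v)` of the transported section `s` on the model `LocalMp F N T_V v` -/

namespace Def411WeilCarriers

variable (F E : Type) [Field F] [NumberField F] [Field E] [NumberField E] [Algebra F E]
variable (c : E ≃ₐ[F] E) (N : ℕ) {n : ℕ} (e : Fin N × Fin 1 ≃ Fin n)
variable (JV : Matrix (Fin N) (Fin N) E) {TV : Matrix (Fin N) (Fin N) F}
variable [Algebra.IsQuadraticExtension F E] {δ : E} (hcδ : c δ = -δ) (hδ : δ ≠ 0) {d : F} (hd : δ * δ = algebraMap F E d)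

omit [NumberField F] [NumberField E] [Algebra.IsQuadraticExtension F E] in
/-- `2 ≤ N` when `3 ≤ n` (`N = n` along `e`; plumbing). [folklore] -/
private theorem two_le_rank₃ (e : Fin N × Fin 1 ≃ Fin n) (hn : 3 ≤ n) : 2 ≤ N := by
  have := Fintype.card_congr e; simp only [Fintype.card_prod, Fintype.card_fin, mul_one] at this; omega

/-- **The `ε`-summand of `LemD1_3AsPrintedI` on the indexed family is a units equation**: `LemD1.SameClass (eps i) (eps j)`
(READING L3′) for the Step-1 representatives `(a_i δ) ⊗ 1`, `(a_j δ) ⊗ 1` says literally `(a_j δ) ⊗ 1 = x · xᶜ · ((a_i δ) ⊗ 1)` for a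
unit `x` of `E_v`, `xᶜ = conjLocal x` (`Iff.rfl`; cf. `sameClass_eps_iff`). [cite: Liu2021, App. D §D.1 Step 1 (l. 5217), Lemma D.1 (3) (l. 5233)] -/
theorem sameClass_eps_localIndexedFamilyAtV_iff (hV : TV.IsSymm) (hVd : IsUnit TV.det)
    (hJV : JV = TV.map (algebraMap F E))
    (hn : 3 ≤ n) {ι : Type} (aOf : ι → Fˣ) (χOf : ι → Chi F E c)
    (𝓢Of : ∀ i, LocalSplitting.FinLocalSplittings F E c n hcδ hδ hd (gram F e TV (TW F (aOf i))) (isSymm_gram F e hV (isSymm_TW F (aOf i)))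
      (reindex_kronecker_eq_gram_map F E e hJV (JW_eq F E (aOf i))))
    (μOf : ι → ∀ v : HeightOneSpectrum (𝓞 F), (LocalRing E v)ˣ →* ℂˣ) (hμn : ∀ i v x, ‖((μOf i v x : ℂˣ) : ℂ)‖ = 1)
    (hμc : ∀ i v, Continuous fun x => ((μOf i v x : ℂˣ) : ℂ))
    (hμF : ∀ (i : ι) (v : HeightOneSpectrum (𝓞 F)) (t : (v.adicCompletion F)ˣ),
      μOf i v (Units.map (algebraMap (v.adicCompletion F) (LocalRing E v)).toMonoidHom t) = 1 ↔
        ∃ x : (LocalRing E v)ˣ, (x : LocalRing E v) * conjLocal E c v x = algebraMap (v.adicCompletion F) (LocalRing E v) t)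
    (v : HeightOneSpectrum (𝓞 F)) (i j : ι) :
    LemD1.SameClass ((localIndexedFamilyAtV F E c N e JV hcδ hδ hd hV hVd hJV hn aOf χOf 𝓢Of μOf hμn hμc hμF v).eps i)
        ((localIndexedFamilyAtV F E c N e JV hcδ hδ hd hV hVd hJV hn aOf χOf 𝓢Of μOf hμn hμc hμF v).eps j) ↔
      ∃ x : (LocalRing E v)ˣ, epsLine E hδ (aOf j) v =
        x * Units.map (conjLocal E c v : LocalRing E v →* LocalRing E v) x * epsLine E hδ (aOf i) v :=
  Iff.rfl

/-- **ONE MEMBER ALONG A LINE-MODEL TRANSPORT.**  Let member `t` of the indexed family of [Liu2021, App. D §D.1]'s data at `v`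
(`localIndexedFamilyAtV … v`: line `⟨a_t⟩`, character `χ_t`, splitting family `𝓢_t` on the pair model
`LocalMp F n (gram e T_V (a_t)) v`, carrier `(𝓢_t).omegaLoc v ∘ (k ↦ k ⊗ 1) ∘ uEquiv`) be given together with a SECTION
`s : U(J_V)(F_v) →* LocalMp F N T_V v` on the model of `V` itself and a linear equivalence `M : 𝒮(F_vᴺ) ≃ 𝒮(F_vⁿ)`
intertwining `ω_s = (MpPsi.toRep (localSchrodinger F N T_V v)).comp s` with `(𝓢_t).omegaLoc v ∘ (k ↦ k ⊗ 1)` (`hM`; for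
`e = Equiv.prodUnique`, `gram = a_t • T_V` and `M = 1` — the `e′_a` model transport).  Then for EVERY hermitian line `J₁` the
member's `ω(μ_v, ε_v, χ_v)` (`quot t`, on `U(V)(F_v) = S.U`) is «isomorphic» (READING L7) to the rank-one theta lift
`Θ_s(χ_{t,v})` of [MoeglinVignerasWaldspurger1987, Chap. 3 IV] in the currency of `RankOneThetaLift.lean` (coinvariants of
`ω_s` under the centre presented at `J₁`), read on `S.U` along `uEquiv`.  Chain: `quot t ≃ X_t ∘ uEquiv`
(`quotEquivLocalType`) · `X_t ≅` coinvariants of `(𝓢_t).omegaLoc v ∘ (k ↦ k ⊗ 1)` (same relation submodule,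
`ker_comp_localLineInl_eq`) · `≅ Θ_s(χ_{t,v})` at the line `(a_t)` (along `M`, `TwistedCoinv.exists_equivariant_of_equivariant`)
· `≅ Θ_s(χ_{t,v})` at `J₁` (`ker_localCenter_eq_of_line`). [cite: Liu2021, App. D §D.1 Step 3 (l. 5221), Lemma D.1 (3) (l. 5233)]
[cite: MoeglinVignerasWaldspurger1987, Chap. 2 II.1, Chap. 3 I.1–I.3] -/
theorem areIsomorphicRep_theta_comp_uEquiv_quot (hV : TV.IsSymm) (hVd : IsUnit TV.det)
    (hJV : JV = TV.map (algebraMap F E))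
    (hn : 3 ≤ n) {ι : Type} (aOf : ι → Fˣ) (χOf : ι → Chi F E c)
    (𝓢Of : ∀ i, LocalSplitting.FinLocalSplittings F E c n hcδ hδ hd (gram F e TV (TW F (aOf i))) (isSymm_gram F e hV (isSymm_TW F (aOf i)))
      (reindex_kronecker_eq_gram_map F E e hJV (JW_eq F E (aOf i))))
    (μOf : ι → ∀ v : HeightOneSpectrum (𝓞 F), (LocalRing E v)ˣ →* ℂˣ) (hμn : ∀ i v x, ‖((μOf i v x : ℂˣ) : ℂ)‖ = 1)
    (hμc : ∀ i v, Continuous fun x => ((μOf i v x : ℂˣ) : ℂ))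
    (hμF : ∀ (i : ι) (v : HeightOneSpectrum (𝓞 F)) (t : (v.adicCompletion F)ˣ),
      μOf i v (Units.map (algebraMap (v.adicCompletion F) (LocalRing E v)).toMonoidHom t) = 1 ↔
        ∃ x : (LocalRing E v)ˣ, (x : LocalRing E v) * conjLocal E c v x = algebraMap (v.adicCompletion F) (LocalRing E v) t)
    (v : HeightOneSpectrum (𝓞 F)) (t : ι)
    (s : localPi E c N JV v →* LocalMp F N TV v)
    (M : SchwartzBruhat (Fin N → v.adicCompletion F) ≃ₗ[ℂ] SchwartzBruhat (Fin n → v.adicCompletion F))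
    (hM : ∀ (g : localPi E c N JV v) (Φ : SchwartzBruhat (Fin N → v.adicCompletion F)),
      M (((MpPsi.toRep (localSchrodinger F N TV v)).comp s) g Φ) =
        (show Representation ℂ (localPi E c N JV v) (SchwartzBruhat (Fin n → v.adicCompletion F)) from
          ((𝓢Of t).omegaLoc v).comp (localLineInl E c N e JV (JW F E (aOf t)) v)) g (M Φ))
    (J₁ : Matrix (Fin 1) (Fin 1) E) (hJ₁ : J₁ 0 0 ≠ 0) :
    AreIsomorphicRep
      (show Representation ℂ (localIndexedFamilyAtV F E c N e JV hcδ hδ hd hV hVd hJV hn aOf χOf 𝓢Of μOf hμn hμc hμF v).S.U _ from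
        (TwistedCoinv.rep
          (ρW := show Representation ℂ (localPi E c 1 J₁ v) (SchwartzBruhat (Fin N → v.adicCompletion F)) from
            ((MpPsi.toRep (localSchrodinger F N TV v)).comp s).comp (localCenter E c N JV J₁ hJ₁ v))
          (localCharOfCenter F E c J₁ hJ₁ (χOf t).1 v) ((MpPsi.toRep (localSchrodinger F N TV v)).comp s)
          (fun g z => (show Commute g (localCenter E c N JV J₁ hJ₁ v z) from
            localCenter_comm E c N JV J₁ hJ₁ v z g).map ((MpPsi.toRep (localSchrodinger F N TV v)).comp s))).comp
        (LemD1OfPlace.uEquiv E v c N JV hcδ hδ (two_le_rank₃ N e hn) (transpose_map_conj_JV F E c N JV hV hJV)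
          (det_JV_ne_zero F E N JV hVd hJV)).toMulEquiv.toMonoidHom)
      ((localIndexedFamilyAtV F E c N e JV hcδ hδ hd hV hVd hJV hn aOf χOf 𝓢Of μOf hμn hμc hμF v).quot t) := by
  -- (1) the as-printed quotient is the local type `X_t` read along `uEquiv`
  have h1 := areIsomorphicRep_of_equiv
    (quotEquivLocalType F E c N e JV hcδ hδ hd hV hVd hJV (aOf t) (𝓢Of t) hn (μOf t) (hμn t) (hμc t) (hμF t) (χOf t) v)
  -- (2) `X_t ≅` the coinvariants of `(𝓢_t).omegaLoc v ∘ (k ↦ k ⊗ 1)` under the centre of `U(J_V)` at the line `(a_t)`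
  have h2 : AreIsomorphicRep
      (show Representation ℂ (localPi E c N JV v) _ from
        (TwistedCoinv.rep (localCharOfCenter F E c (JW F E (aOf t)) (JW_apply_ne_zero F E (aOf t)) (χOf t).1 v) ((𝓢Of t).omegaLoc v)
          (commute_omegaLoc_localCenter F E c N e JV (JW F E (aOf t)) hcδ hδ hd hV (isSymm_TW F (aOf t)) hJV (JW_eq F E (aOf t))
            (JW_apply_ne_zero F E (aOf t)) (𝓢Of t) v)).comp (localLineInl E c N e JV (JW F E (aOf t)) v))
      (TwistedCoinv.rep
        (ρW := show Representation ℂ (localPi E c 1 (JW F E (aOf t)) v) (SchwartzBruhat (Fin n → v.adicCompletion F)) from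
          (show Representation ℂ (localPi E c N JV v) (SchwartzBruhat (Fin n → v.adicCompletion F)) from
            ((𝓢Of t).omegaLoc v).comp (localLineInl E c N e JV (JW F E (aOf t)) v)).comp
            (localCenter E c N JV (JW F E (aOf t)) (JW_apply_ne_zero F E (aOf t)) v))
        (localCharOfCenter F E c (JW F E (aOf t)) (JW_apply_ne_zero F E (aOf t)) (χOf t).1 v)
        (show Representation ℂ (localPi E c N JV v) (SchwartzBruhat (Fin n → v.adicCompletion F)) from
          ((𝓢Of t).omegaLoc v).comp (localLineInl E c N e JV (JW F E (aOf t)) v))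
        (fun g z => (show Commute g (localCenter E c N JV (JW F E (aOf t)) (JW_apply_ne_zero F E (aOf t)) v z) from
          localCenter_comm E c N JV (JW F E (aOf t)) (JW_apply_ne_zero F E (aOf t)) v z g).map
            (show Representation ℂ (localPi E c N JV v) (SchwartzBruhat (Fin n → v.adicCompletion F)) from
              ((𝓢Of t).omegaLoc v).comp (localLineInl E c N e JV (JW F E (aOf t)) v)))) :=
    areIsomorphicRep_coinv_of_ker_eq (ker_comp_localLineInl_eq F E c N e JV hcδ hδ hd hV hJV (aOf t) (𝓢Of t) (χOf t) v).symm _ _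
      (fun g => (𝓢Of t).omegaLoc v (localLineInl E c N e JV (JW F E (aOf t)) v g)) (fun _ _ => rfl) (fun _ _ => rfl)
  -- (3) along `M`: `Θ_s(χ_{t,v})` at the line `(a_t)` `≅` those coinvariants
  have h3 := TwistedCoinv.exists_equivariant_of_equivariant ((MpPsi.toRep (localSchrodinger F N TV v)).comp s)
    (show Representation ℂ (localPi E c N JV v) (SchwartzBruhat (Fin n → v.adicCompletion F)) from
      ((𝓢Of t).omegaLoc v).comp (localLineInl E c N e JV (JW F E (aOf t)) v))
    (localCenter E c N JV (JW F E (aOf t)) (JW_apply_ne_zero F E (aOf t)) v)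
    (localCharOfCenter F E c (JW F E (aOf t)) (JW_apply_ne_zero F E (aOf t)) (χOf t).1 v)
    (fun g z => (show Commute g (localCenter E c N JV (JW F E (aOf t)) (JW_apply_ne_zero F E (aOf t)) v z) from
      localCenter_comm E c N JV (JW F E (aOf t)) (JW_apply_ne_zero F E (aOf t)) v z g).map
        ((MpPsi.toRep (localSchrodinger F N TV v)).comp s))
    (fun g z => (show Commute g (localCenter E c N JV (JW F E (aOf t)) (JW_apply_ne_zero F E (aOf t)) v z) from
      localCenter_comm E c N JV (JW F E (aOf t)) (JW_apply_ne_zero F E (aOf t)) v z g).map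
        (show Representation ℂ (localPi E c N JV v) (SchwartzBruhat (Fin n → v.adicCompletion F)) from
          ((𝓢Of t).omegaLoc v).comp (localLineInl E c N e JV (JW F E (aOf t)) v)))
    M hM
  -- (4) change of the line presenting the centre: `(a_t)` ↦ `J₁`
  have h4 : AreIsomorphicRep
      (TwistedCoinv.rep
        (ρW := show Representation ℂ (localPi E c 1 J₁ v) (SchwartzBruhat (Fin N → v.adicCompletion F)) from
          ((MpPsi.toRep (localSchrodinger F N TV v)).comp s).comp (localCenter E c N JV J₁ hJ₁ v))
        (localCharOfCenter F E c J₁ hJ₁ (χOf t).1 v) ((MpPsi.toRep (localSchrodinger F N TV v)).comp s)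
        (fun g z => (show Commute g (localCenter E c N JV J₁ hJ₁ v z) from
          localCenter_comm E c N JV J₁ hJ₁ v z g).map ((MpPsi.toRep (localSchrodinger F N TV v)).comp s)))
      (TwistedCoinv.rep
        (ρW := show Representation ℂ (localPi E c 1 (JW F E (aOf t)) v) (SchwartzBruhat (Fin N → v.adicCompletion F)) from
          ((MpPsi.toRep (localSchrodinger F N TV v)).comp s).comp
            (localCenter E c N JV (JW F E (aOf t)) (JW_apply_ne_zero F E (aOf t)) v))
        (localCharOfCenter F E c (JW F E (aOf t)) (JW_apply_ne_zero F E (aOf t)) (χOf t).1 v)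
        ((MpPsi.toRep (localSchrodinger F N TV v)).comp s)
        (fun g z => (show Commute g (localCenter E c N JV (JW F E (aOf t)) (JW_apply_ne_zero F E (aOf t)) v z) from
          localCenter_comm E c N JV (JW F E (aOf t)) (JW_apply_ne_zero F E (aOf t)) v z g).map
            ((MpPsi.toRep (localSchrodinger F N TV v)).comp s))) :=
    areIsomorphicRep_coinv_of_ker_eq
      (LemD1OfPlace.ker_localCenter_eq_of_line E v c N JV hcδ hδ (two_le_rank₃ N e hn) (transpose_map_conj_JV F E c N JV hV hJV)
        (det_JV_ne_zero F E N JV hVd hJV) ((MpPsi.toRep (localSchrodinger F N TV v)).comp s) (χOf t).1 J₁ (JW F E (aOf t)) hJ₁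
        (JW_apply_ne_zero F E (aOf t))) _ _
      (fun g => ((MpPsi.toRep (localSchrodinger F N TV v)).comp s) g) (fun _ _ => rfl) (fun _ _ => rfl)
  -- compose: `Θ_s(χ)_{J₁} ≅ Θ_s(χ)_{(a_t)} ≅ Coinv(ω_t ∘ inl) ≅ X_t`, then read on `S.U` along `uEquiv`
  exact (((h4.trans h3).trans h2.symm).comp _).trans h1.symm


/-! ## §3 [Lem. D.1 (3)] AS PRINTED on `localIndexedFamilyAtV … v`, `(ε, χ)`-clauses (→), `N = 3`, NON-SPLIT `v` — from the
separation of rank-one theta lifts (`rankOne_theta_sameClass_and_char_eq_of_areIsomorphicRep`, conditional on row IV-4c1) -/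

section Three

variable {n : ℕ} (e : Fin 3 × Fin 1 ≃ Fin n) (JV : Matrix (Fin 3) (Fin 3) E) {TV : Matrix (Fin 3) (Fin 3) F}

omit [NumberField F] [NumberField E] [Algebra.IsQuadraticExtension F E] in
/-- in a commutative group with an endomorphism `σ`: `a = z · σ z · b ⟹ b = z⁻¹ · σ z⁻¹ · a` (plumbing for the class
relation `SameClass`). [folklore] -/
private theorem eq_inv_mul_of_eq_mul {G : Type*} [CommGroup G] (σ : G →* G) {a b z : G} (h : a = z * σ z * b) :
    b = z⁻¹ * σ z⁻¹ * a := by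
  rw [h, map_inv, mul_comm z⁻¹ (σ z)⁻¹]
  group

omit [NumberField F] [NumberField E] [Algebra.IsQuadraticExtension F E] in
/-- in a commutative group with an endomorphism `σ`: if `eᵢ = x σx eⱼ`, `eᵢ = yᵢ σyᵢ Eᵢ`, `eⱼ = yⱼ σyⱼ Eⱼ` then
`Eⱼ = w σw Eᵢ` with `w = (yᵢ⁻¹ x yⱼ)⁻¹` (plumbing for the class relation `SameClass`). [folklore] -/
private theorem sameClass_witness {G : Type*} [CommGroup G] (σ : G →* G) {ei ej Ei Ej x yi yj : G}
    (hx : ei = x * σ x * ej) (hyi : ei = yi * σ yi * Ei) (hyj : ej = yj * σ yj * Ej) :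
    Ej = (yi⁻¹ * x * yj)⁻¹ * σ (yi⁻¹ * x * yj)⁻¹ * Ei := by
  refine eq_inv_mul_of_eq_mul σ ?_
  rw [eq_inv_mul_of_eq_mul σ hyi, hx, hyj, map_mul, map_mul, map_inv]
  simp only [mul_assoc, mul_comm, mul_left_comm]

/-- **[Liu2021, App. D Lem. D.1 (3)], `(ε, χ)`-CLAUSES (→ direction) AT A NON-SPLIT PLACE on the indexed family
`localIndexedFamilyAtV … v` of §D.1's data for `V` itself (`N = 3`), CONDITIONAL on the named fact IV-4c1
`rankOne_theta_lines_disjoint`, THROUGH LINE-MODEL TRANSPORTS.**  Hypotheses: `h : rankOne_theta_lines_disjoint`; `E_v` a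
field (`hE`); for every member `t`, a trace-zero `δ'_t` (`δ'_t² = d'_t`) whose representative `δ'_t ⊗ 1` lies in the class of
the member's `ε_{t,v} = (a_t δ) ⊗ 1` (`hy`), a SECTION `s_t : U(J_V)(F_v) →* LocalMp F 3 T_V v` over `ι_{δ'_t}` (`hs`) with
`ω_{s_t}` smooth (`hsm`) and a linear equivalence `M_t : 𝒮(F_v³) ≃ 𝒮(F_vⁿ)` intertwining `ω_{s_t}` with
`(𝓢_t).omegaLoc v ∘ (k ↦ k ⊗ 1)` (`hM`) — the `e′_a` model transport for `e = Equiv.prodUnique`, `δ'_t = a_t⁻¹ δ`, `M_t = 1`.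
THEN «`ω(μ_j, ε_j, χ_j) ≅ ω(μ_i, ε_i, χ_i)`» (`AreIsomorphicRep (quot j) (quot i)`, READING L7) forces `ε_i`, `ε_j` into ONE class
of `E_v^{−×}/Nm E_vˣ` (`LemD1.SameClass (eps i) (eps j)`) AND `χ_j = χ_i` (`chi j = chi i`) — the literal `ε`- and `χ`-summands of
`LemD1_3AsPrintedI`'s right-hand side.  Proof: §2 for `i` and `j` puts both members in the currency of
`rankOne_theta_sameClass_and_char_eq_of_areIsomorphicRep` (one model `T_V`, two lines `δ'_j`, `δ'_i`, the centre at the line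
`(a_j)`); non-vanishing of `Θ_{s_j}(χ_j)` is [MoeglinVignerasWaldspurger1987, Chap. 3 IV.2] PROVED
(`mvw_IV2_rankOne_nonvanishing_of_isotropic_holds`) at the isotropic (`isIsotropic_standingData_of_three_le`) rank-3 space;
the classes of `δ'_t ⊗ 1` and `(a_t δ) ⊗ 1` agree by `hy`, the characters at `S.normOne` by `localCharOfCenter_theta_eq`.
[cite: Liu2021, App. D Lemma D.1 (3) (l. 5233) and proof l. 5255 (= GelbartRogawski1990 Prop. 5.1.4, n = 3)]
[cite: MoeglinVignerasWaldspurger1987, Chap. 3 IV.2, IV.4] -/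
theorem sameClass_and_chi_eq_of_areIsomorphicRep_nonsplit_of_modelTransport (h : rankOne_theta_lines_disjoint)
    (hV : TV.IsSymm) (hVd : IsUnit TV.det) (hJV : JV = TV.map (algebraMap F E))
    (hn : 3 ≤ n) {ι : Type} (aOf : ι → Fˣ) (χOf : ι → Chi F E c)
    (𝓢Of : ∀ i, LocalSplitting.FinLocalSplittings F E c n hcδ hδ hd (gram F e TV (TW F (aOf i))) (isSymm_gram F e hV (isSymm_TW F (aOf i)))
      (reindex_kronecker_eq_gram_map F E e hJV (JW_eq F E (aOf i))))
    (μOf : ι → ∀ v : HeightOneSpectrum (𝓞 F), (LocalRing E v)ˣ →* ℂˣ) (hμn : ∀ i v x, ‖((μOf i v x : ℂˣ) : ℂ)‖ = 1)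
    (hμc : ∀ i v, Continuous fun x => ((μOf i v x : ℂˣ) : ℂ))
    (hμF : ∀ (i : ι) (v : HeightOneSpectrum (𝓞 F)) (t : (v.adicCompletion F)ˣ),
      μOf i v (Units.map (algebraMap (v.adicCompletion F) (LocalRing E v)).toMonoidHom t) = 1 ↔
        ∃ x : (LocalRing E v)ˣ, (x : LocalRing E v) * conjLocal E c v x = algebraMap (v.adicCompletion F) (LocalRing E v) t)
    (v : HeightOneSpectrum (𝓞 F)) (hE : IsField (LocalRing E v)) (i j : ι)
    (δ' : ι → E) (hcδ' : ∀ t, c (δ' t) = -δ' t) (hδ' : ∀ t, δ' t ≠ 0) (d' : ι → F)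
    (hd' : ∀ t, δ' t * δ' t = algebraMap F E (d' t))
    (hy : ∀ t, ∃ y : (LocalRing E v)ˣ, LemD1OfPlace.eps E v (hδ' t) =
      y * Units.map (conjLocal E c v : LocalRing E v →* LocalRing E v) y * epsLine E hδ (aOf t) v)
    (s : ι → (localPi E c 3 JV v →* LocalMp F 3 TV v))
    (hs : ∀ t g, MpPsi.proj _ (s t g) = iota F E c 3 (hcδ' t) (hδ' t) (hd' t) TV hV hJV v g)
    (hsm : ∀ t, Representation.IsSmooth ((MpPsi.toRep (localSchrodinger F 3 TV v)).comp (s t)))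
    (M : ι → (SchwartzBruhat (Fin 3 → v.adicCompletion F) ≃ₗ[ℂ] SchwartzBruhat (Fin n → v.adicCompletion F)))
    (hM : ∀ (t : ι) (g : localPi E c 3 JV v) (Φ : SchwartzBruhat (Fin 3 → v.adicCompletion F)),
      M t (((MpPsi.toRep (localSchrodinger F 3 TV v)).comp (s t)) g Φ) =
        (show Representation ℂ (localPi E c 3 JV v) (SchwartzBruhat (Fin n → v.adicCompletion F)) from
          ((𝓢Of t).omegaLoc v).comp (localLineInl E c 3 e JV (JW F E (aOf t)) v)) g (M t Φ))
    (hiso : AreIsomorphicRep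
      ((localIndexedFamilyAtV F E c 3 e JV hcδ hδ hd hV hVd hJV hn aOf χOf 𝓢Of μOf hμn hμc hμF v).quot j)
      ((localIndexedFamilyAtV F E c 3 e JV hcδ hδ hd hV hVd hJV hn aOf χOf 𝓢Of μOf hμn hμc hμF v).quot i)) :
    LemD1.SameClass ((localIndexedFamilyAtV F E c 3 e JV hcδ hδ hd hV hVd hJV hn aOf χOf 𝓢Of μOf hμn hμc hμF v).eps i)
        ((localIndexedFamilyAtV F E c 3 e JV hcδ hδ hd hV hVd hJV hn aOf χOf 𝓢Of μOf hμn hμc hμF v).eps j) ∧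
      (localIndexedFamilyAtV F E c 3 e JV hcδ hδ hd hV hVd hJV hn aOf χOf 𝓢Of μOf hμn hμc hμF v).chi j =
        (localIndexedFamilyAtV F E c 3 e JV hcδ hδ hd hV hVd hJV hn aOf χOf 𝓢Of μOf hμn hμc hμF v).chi i := by
  have hJh : (JV.map c)ᵀ = JV := transpose_map_conj_JV F E c 3 JV hV hJV
  have hJdet : JV.det ≠ 0 := det_JV_ne_zero F E 3 JV hVd hJV
  -- unitarity and continuity of the local components `χ_{t,v}` at the line `(a_j)`
  have hχu : ∀ t z, ‖((localCharOfCenter F E c (JW F E (aOf j)) (JW_apply_ne_zero F E (aOf j)) (χOf t).1 v z : ℂˣ) : ℂ)‖ = 1 :=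
    fun t => norm_localCharOfCenter F E c (JW F E (aOf j)) (JW_apply_ne_zero F E (aOf j))
      (norm_chi_eq_one F E c (Algebra.IsQuadraticExtension.finrank_eq_two F E)
        (UnitaryGroup.algEquiv_ne_one_of_apply_eq_neg F E c hcδ hδ) (χOf t)) v
  have hχc : ∀ t, Continuous fun z => ((localCharOfCenter F E c (JW F E (aOf j)) (JW_apply_ne_zero F E (aOf j)) (χOf t).1 v z : ℂˣ) : ℂ) :=
    fun t => continuous_coe_localCharOfCenter F E c (JW F E (aOf j)) (JW_apply_ne_zero F E (aOf j)) (χOf t).2.1 v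
  -- (a) both members in the currency of the separation theorem (§2), at the common line `(a_j)`
  have hj := areIsomorphicRep_theta_comp_uEquiv_quot F E c 3 e JV hcδ hδ hd hV hVd hJV hn aOf χOf 𝓢Of μOf hμn hμc hμF v j
    (s j) (M j) (hM j) (JW F E (aOf j)) (JW_apply_ne_zero F E (aOf j))
  have hi := areIsomorphicRep_theta_comp_uEquiv_quot F E c 3 e JV hcδ hδ hd hV hVd hJV hn aOf χOf 𝓢Of μOf hμn hμc hμF v i
    (s i) (M i) (hM i) (JW F E (aOf j)) (JW_apply_ne_zero F E (aOf j))
  have hisoY := AreIsomorphicRep.of_comp_surjective _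
    (LemD1OfPlace.uEquiv E v c 3 JV hcδ hδ (two_le_rank₃ 3 e hn) hJh hJdet).surjective ((hj.trans hiso).trans hi.symm)
  -- (b) `Θ_{s_j}(χ_j) ≠ 0`: MVW IV.2 (proved) at the isotropic rank-3 space
  have hnt := mvw_IV2_rankOne_nonvanishing_of_isotropic_holds F E c 3 (δ' j) (hcδ' j) (hδ' j) (d' j) (hd' j) TV hV hVd JV hJV
    v hE (by norm_num) hJh hJdet
    (LemD1OfPlace.isIsotropic_standingData_of_three_le E v c 3 JV (hcδ' j) (hδ' j) (by norm_num) hJh hJdet le_rfl)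
    (s j) (hs j) (hsm j) (JW F E (aOf j)) (JW_apply_ne_zero F E (aOf j))
    (localCharOfCenter F E c (JW F E (aOf j)) (JW_apply_ne_zero F E (aOf j)) (χOf j).1 v) (hχu j) (hχc j)
  -- (c) the separation theorem
  obtain ⟨hε, hχ⟩ := rankOne_theta_epsClass_and_char_eq_of_areIsomorphicRep h F E c (δ' j) (hcδ' j) (hδ' j) (d' j) (hd' j)
    (δ' i) (hcδ' i) (hδ' i) (d' i) (hd' i) TV hV hVd JV hJV v hE (s j) (s i) (hs j) (hs i) (hsm j) (hsm i)
    (JW F E (aOf j)) (JW_apply_ne_zero F E (aOf j))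
    (localCharOfCenter F E c (JW F E (aOf j)) (JW_apply_ne_zero F E (aOf j)) (χOf j).1 v)
    (localCharOfCenter F E c (JW F E (aOf j)) (JW_apply_ne_zero F E (aOf j)) (χOf i).1 v)
    (hχu j) (hχc j) (hχu i) (hχc i) hnt hisoY
  refine ⟨?_, ?_⟩
  · -- (ε) `δ'_i ⊗ 1 = x xᶜ (δ'_j ⊗ 1)` and `δ'_t ⊗ 1 = y_t y_tᶜ ((a_t δ) ⊗ 1)` ⟹ `(a_j δ) ⊗ 1 = w wᶜ ((a_i δ) ⊗ 1)`
    obtain ⟨x, hx⟩ := hε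
    obtain ⟨yi, hyi⟩ := hy i
    obtain ⟨yj, hyj⟩ := hy j
    exact (sameClass_eps_localIndexedFamilyAtV_iff F E c 3 e JV hcδ hδ hd hV hVd hJV hn aOf χOf 𝓢Of μOf hμn hμc hμF v i j).2
      ⟨(yi⁻¹ * x * yj)⁻¹, sameClass_witness (Units.map (conjLocal E c v : LocalRing E v →* LocalRing E v)) hx hyi hyj⟩
  · -- (χ) `χ_{j,v} = χ_{i,v}` at the line `(a_j)` ⟹ `χ_j ∘ θ_{(a_j)} = χ_i ∘ θ_{(a_i)}` on `E_v¹`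
    refine Subtype.ext (MonoidHom.ext fun z => ?_)
    change localCharOfCenter F E c (JW F E (aOf j)) (JW_apply_ne_zero F E (aOf j)) (χOf j).1 v
        (LemD1OfPlace.theta E v c 3 JV hcδ hδ _ _ _ (JW F E (aOf j)) z) =
      localCharOfCenter F E c (JW F E (aOf i)) (JW_apply_ne_zero F E (aOf i)) (χOf i).1 v
        (LemD1OfPlace.theta E v c 3 JV hcδ hδ _ _ _ (JW F E (aOf i)) z)
    rw [hχ, localCharOfCenter_theta_eq F E c 3 JV hcδ hδ _ _ _ v (JW F E (aOf j)) (JW F E (aOf i))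
      (JW_apply_ne_zero F E (aOf j)) (JW_apply_ne_zero F E (aOf i)) (χOf i).1 z]

end Three

end Def411WeilCarriers

end Literature.NumberTheory.Automorphic.Liu2021

end
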